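import Mathlib
import Literature.NumberTheory.Irrationality.BrownZudilin2022.WellPoisedDual
import Literature.NumberTheory.Irrationality.CressonFischlerRivoal2008.WellPoisedSymmetry
import HarnessLib

/-!
# The dual very-well-poised series `F̃₇(b)` on the integer box: polynomial form and decomposition

Cell `pub-zeta5` (HONEST FRAMING: systematic search; no irrationality claim unless certified), typer seat,
generation 3.  OUR work (Summit side), built on the cited Literature objects
`Literature.NumberTheory.Irrationality.BrownZudilin2022.vwpDual` (Brown–Zudilin, arXiv:2210.03391, (34)) and
`Literature.NumberTheory.Irrationality.CressonFischlerRivoal2008.theoreme1_holds` (Cresson–Fischler–Rivoal 2008,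
Théorème 1, PROVED in the tree).  Companion file: `DualSeriesContiguity.lean` (Lemma 1 of the cell's wedge
dictionary).

For INTEGER parameters `b = (b₀; b₁,…,b₇)` with `0 ≤ b₀` and `0 ≤ b_j ≤ b₀ + 1` (`InBox b`; the products of (34) are
written over `j + 1`, `j < 7`, exactly as in `vwpDual_eq_tsum`):

* `term b μ` — the `μ`-th term of the printed series (34) for `k = 7` (`vwpDual_seven_eq_tsum`);
* `numPoly b = (2X + b₀) · ∏_{j=1}^{7} (X)_{b_j} (X + b₀ − b_j + 1)_{b_j} ∈ ℚ[X]` and the POLYNOMIAL FORM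
  `term b μ = numPoly_b(μ+1) / (μ+1)_{b₀+1}^6` (`term_eq`: every Gamma value in (34) is taken at a positive integer,
  `Γ(x+n) = (x)_n Γ(x)`);
* `natDegree (numPoly b) ≤ 1 + 2 Σ_j b_j` (`natDegree_numPoly_le`) and the well-poised REFLECTION
  `numPoly_b(−b₀−X) = −numPoly_b(X)` (`numPoly_reflect`), i.e. the hypotheses of Cresson–Fischler–Rivoal's
  Théorème 1 with `A = 6`, `n = b₀` as soon as `Σ_j b_j ≤ 3b₀ + 1`;
* hence (`exists_hasSum_term`, `summable_term`, `vwpDual_seven_mem`): the series converges and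
  `F̃₇(b) = u·ζ(5) + w·ζ(3) − v` for some RATIONAL `u, w, v` — Brown–Zudilin's remark "`F̃₇(b) ∈ ℚ + ℚζ(3) + ℚζ(5)`"
  printed under (35), here a theorem for `0 ≤ b_j ≤ b₀ + 1`, `Σ_j b_j ≤ 3b₀ + 1` (the printed `ℤζ(5)` refinement,
  which needs the arithmetic normalisation (35), is not claimed).
-/

noncomputable section

open Finset Polynomial

namespace Summit.KontsevichZagierPeriods.Zeta5Search.DualSeries

open Literature.NumberTheory.Irrationality.BrownZudilin2022 (vwpDual vwpDual_eq_tsum)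
open Literature.NumberTheory.Irrationality.CressonFischlerRivoal2008 (poch theoreme1_holds)
open Literature.NumberTheory.Transcendental (zetaValue)
open Literature.NumberTheory.Transcendental.BallRivoal (pochPoly eval_pochPoly poch_reflect)

/-! ### The objects -/

/-- The integer box on which the polynomial form holds: `0 ≤ b₀` and `0 ≤ b_{j+1} ≤ b₀ + 1` for `j < 7`. -/
def InBox (b : ℕ → ℤ) : Prop := 0 ≤ b 0 ∧ ∀ j ∈ range 7, 0 ≤ b (j + 1) ∧ b (j + 1) ≤ b 0 + 1

/-- The `μ`-th term of the series (34) for `k = 7`, literally as in `vwpDual_eq_tsum`. -/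
def term (b : ℕ → ℤ) (μ : ℕ) : ℝ :=
  ((b 0 : ℝ) + 2 * μ + 2) *
      ((Real.Gamma ((b 0 : ℝ) + μ + 2) * ∏ j ∈ range 7, Real.Gamma ((b (j + 1) : ℝ) + μ + 1)) /
        ((μ.factorial : ℝ) * ∏ j ∈ range 7, Real.Gamma ((b 0 : ℝ) - b (j + 1) + μ + 2))) *
    (-1 : ℝ) ^ ((7 + 1) * μ)

/-- `F̃₇(b) = Σ_μ term b μ` (the printed series (34), `k = 7`). -/
theorem vwpDual_seven_eq_tsum (b : ℕ → ℤ) : vwpDual 7 b = ∑' μ : ℕ, term b μ :=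
  vwpDual_eq_tsum 7 b

/-- The numerator polynomial `numPoly b = (2X + b₀) · ∏_{j=1}^{7} (X)_{b_j} · (X + b₀ − b_j + 1)_{b_j} ∈ ℚ[X]`
(Pochhammer factors as `BallRivoal.pochPoly`; `b_j` through `Int.toNat`). -/
def numPoly (b : ℕ → ℤ) : ℚ[X] :=
  (C 2 * X + C (b 0 : ℚ)) *
    ∏ j ∈ range 7, (pochPoly 0 (b (j + 1)).toNat * pochPoly ((b 0 - b (j + 1) + 1 : ℤ) : ℚ) (b (j + 1)).toNat)

/-- Real Pochhammer product `(x)_n = ∏_{s<n} (x + s)`. -/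
def rp (x : ℝ) (n : ℕ) : ℝ := ∏ s ∈ range n, (x + s)

/-! ### Pochhammer bookkeeping -/

/-- `(x)_{m+n} = (x)_m (x+m)_n`. -/
theorem rp_add (x : ℝ) (m n : ℕ) : rp x (m + n) = rp x m * rp (x + m) n := by
  unfold rp
  rw [prod_range_add]
  congr 1
  refine prod_congr rfl fun s _ => ?_
  push_cast
  ring

/-- `(x)_n > 0` for `x > 0`. -/
theorem rp_pos {x : ℝ} (hx : 0 < x) (n : ℕ) : 0 < rp x n :=
  prod_pos fun s _ => by positivity

/-- `Γ(x + n) = (x)_n Γ(x)` for `x > 0`. -/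
theorem Gamma_add_nat_eq (x : ℝ) (hx : 0 < x) (n : ℕ) :
    Real.Gamma (x + n) = rp x n * Real.Gamma x := by
  induction n with
  | zero => simp [rp]
  | succ n ih =>
    have hne : x + n ≠ 0 := by positivity
    rw [Nat.cast_succ, ← add_assoc, Real.Gamma_add_one hne, ih]
    unfold rp
    rw [prod_range_succ]
    ring

/-- `aeval y (pochPoly β n) = (y + β)_n`. -/
theorem aeval_pochPoly (β : ℚ) (n : ℕ) (y : ℝ) : aeval y (pochPoly β n) = rp (y + β) n := by
  unfold pochPoly rp
  rw [map_prod]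
  refine prod_congr rfl fun s _ => ?_
  rw [map_add, aeval_X, aeval_C, eq_ratCast]
  push_cast
  ring

/-- `aeval y (numPoly b) = (2y + b₀) ∏_j (y)_{b_j} (y + b₀ − b_j + 1)_{b_j}`. -/
theorem aeval_numPoly (b : ℕ → ℤ) (y : ℝ) :
    aeval y (numPoly b) = (2 * y + b 0) * ∏ j ∈ range 7,
      (rp y (b (j + 1)).toNat * rp (y + ((b 0 - b (j + 1) + 1 : ℤ) : ℝ)) (b (j + 1)).toNat) := by
  unfold numPoly
  rw [map_mul, map_prod]
  congr 1
  · rw [map_add, map_mul, aeval_C, aeval_X, aeval_C, eq_ratCast, eq_ratCast]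
    push_cast
    ring
  · refine prod_congr rfl fun j _ => ?_
    rw [map_mul, aeval_pochPoly, aeval_pochPoly]
    simp only [Rat.cast_zero, add_zero, Rat.cast_intCast]

/-- CFR's `poch (μ+1) B = (μ+1)_{B+1}`. -/
theorem poch_eq_rp (μ B : ℕ) : poch (μ + 1) B = rp ((μ : ℝ) + 1) (B + 1) := by
  unfold poch rp
  refine prod_congr rfl fun s _ => ?_
  push_cast
  ring


/-! ### The polynomial form of the summand -/

/-- The algebra behind `term_eq`: with `∏_j G_j g_j = (r₀ m)^7`,
`X · (r₀ m ∏_j f_j m)/(m ∏_j G_j) = X ∏_j f_j g_j / r₀^6`. -/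
theorem key_identity (X m r₀ : ℝ) (f g G : ℕ → ℝ) (hm : m ≠ 0) (hr : r₀ ≠ 0)
    (hG : ∀ j ∈ range 7, G j ≠ 0) (hGg : ∀ j ∈ range 7, G j * g j = r₀ * m) :
    X * ((r₀ * m * ∏ j ∈ range 7, (f j * m)) / (m * ∏ j ∈ range 7, G j)) =
      X * (∏ j ∈ range 7, (f j * g j)) / r₀ ^ 6 := by
  have hP : (∏ j ∈ range 7, G j) * ∏ j ∈ range 7, g j = (r₀ * m) ^ 7 := by
    rw [← prod_mul_distrib, prod_congr rfl hGg, prod_const, card_range]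
  have hden : m * ∏ j ∈ range 7, G j ≠ 0 := mul_ne_zero hm (prod_ne_zero_iff.2 hG)
  rw [mul_div_assoc', div_eq_div_iff hden (pow_ne_zero _ hr), prod_mul_distrib, prod_mul_distrib,
    prod_const, card_range]
  linear_combination (-(X * m * ∏ j ∈ range 7, f j)) * hP

/-- POLYNOMIAL FORM of the summand of (34) (`k = 7`): on the box every Gamma value is taken at a positive
integer, and `term b μ = numPoly_b(μ+1) / (μ+1)_{b₀+1}^6`. -/
theorem term_eq (b : ℕ → ℤ) (hb : InBox b) (μ : ℕ) :
    term b μ = aeval ((μ : ℝ) + 1) (numPoly b) / poch (μ + 1) (b 0).toNat ^ 6 := by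
  obtain ⟨h0, hj⟩ := hb
  set B := (b 0).toNat with hB
  set x : ℝ := (μ : ℝ) + 1 with hx
  have x_pos : 0 < x := by positivity
  have hb0 : (b 0 : ℝ) = (B : ℝ) := by
    have h := Int.toNat_of_nonneg h0
    rw [hB]
    exact_mod_cast h.symm
  have hbj : ∀ j ∈ range 7, (b (j + 1) : ℝ) = ((b (j + 1)).toNat : ℝ) := fun j hj' => by
    have h := Int.toNat_of_nonneg (hj j hj').1
    exact_mod_cast h.symm
  have hle : ∀ j ∈ range 7, (b (j + 1)).toNat ≤ B + 1 := fun j hj' => by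
    have h := (hj j hj').2
    omega
  -- `γ_j = B + 1 - b_j` as a natural number, and its casts
  have hγ : ∀ j ∈ range 7, ((B + 1 - (b (j + 1)).toNat : ℕ) : ℝ) = (b 0 : ℝ) - b (j + 1) + 1 := fun j hj' => by
    rw [Nat.cast_sub (hle j hj'), hb0, hbj j hj']
    push_cast
    ring
  have hfact : Real.Gamma x = (μ.factorial : ℝ) := Real.Gamma_nat_eq_factorial μ
  have hfact_ne : (μ.factorial : ℝ) ≠ 0 := by positivity
  have hΓ0 : Real.Gamma ((b 0 : ℝ) + μ + 2) = rp x (B + 1) * (μ.factorial : ℝ) := by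
    rw [show (b 0 : ℝ) + μ + 2 = x + ((B + 1 : ℕ) : ℝ) by rw [hb0, hx]; push_cast; ring,
      Gamma_add_nat_eq x x_pos, hfact]
  have hΓ1 : ∀ j ∈ range 7, Real.Gamma ((b (j + 1) : ℝ) + μ + 1) =
      rp x (b (j + 1)).toNat * (μ.factorial : ℝ) := fun j hj' => by
    rw [show (b (j + 1) : ℝ) + μ + 1 = x + ((b (j + 1)).toNat : ℝ) by rw [hbj j hj', hx]; ring,
      Gamma_add_nat_eq x x_pos, hfact]
  have hΓ2 : ∀ j ∈ range 7, Real.Gamma ((b 0 : ℝ) - b (j + 1) + μ + 2) =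
      rp x (B + 1 - (b (j + 1)).toNat) * (μ.factorial : ℝ) := fun j hj' => by
    rw [show (b 0 : ℝ) - b (j + 1) + μ + 2 = x + ((B + 1 - (b (j + 1)).toNat : ℕ) : ℝ) by
        rw [hγ j hj', hx]; ring,
      Gamma_add_nat_eq x x_pos, hfact]
  have hsplit : ∀ j ∈ range 7, rp x (B + 1 - (b (j + 1)).toNat) *
      rp (x + ((B + 1 - (b (j + 1)).toNat : ℕ) : ℝ)) (b (j + 1)).toNat = rp x (B + 1) := fun j hj' => by
    rw [← rp_add]
    congr 1
    have := hle j hj'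
    omega
  have hr : rp x (B + 1) ≠ 0 := (rp_pos x_pos _).ne'
  have hsign : (-1 : ℝ) ^ ((7 + 1) * μ) = 1 := by
    rw [pow_mul]
    norm_num
  -- rewrite both sides into the shape of `key_identity`
  unfold term
  rw [hsign, mul_one, hΓ0, prod_congr rfl hΓ1, aeval_numPoly, poch_eq_rp, ← hx,
    show (b 0 : ℝ) + 2 * μ + 2 = 2 * x + b 0 by rw [hx]; ring]
  have hg : ∀ j ∈ range 7, rp x (b (j + 1)).toNat * rp (x + ((b 0 - b (j + 1) + 1 : ℤ) : ℝ)) (b (j + 1)).toNat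
      = rp x (b (j + 1)).toNat * rp (x + ((B + 1 - (b (j + 1)).toNat : ℕ) : ℝ)) (b (j + 1)).toNat :=
    fun j hj' => by
      rw [hγ j hj']
      push_cast
      ring_nf
  rw [prod_congr rfl hg]
  refine key_identity (2 * x + b 0) (μ.factorial : ℝ) (rp x (B + 1)) (fun j => rp x (b (j + 1)).toNat)
    (fun j => rp (x + ((B + 1 - (b (j + 1)).toNat : ℕ) : ℝ)) (b (j + 1)).toNat)
    (fun j => Real.Gamma ((b 0 : ℝ) - b (j + 1) + μ + 2)) hfact_ne hr ?_ ?_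
  · intro j hj'
    rw [hΓ2 j hj']
    exact mul_ne_zero (rp_pos x_pos _).ne' hfact_ne
  · intro j hj'
    rw [hΓ2 j hj', mul_right_comm, hsplit j hj']


/-! ### Degree and reflection of `numPoly` (the hypotheses of Cresson–Fischler–Rivoal, Théorème 1) -/

/-- `deg (X+β)_n ≤ n`. -/
theorem natDegree_pochPoly_le (β : ℚ) (n : ℕ) : (pochPoly β n).natDegree ≤ n := by
  unfold pochPoly
  refine (natDegree_prod_le _ _).trans ?_
  refine (sum_le_sum fun s _ => (natDegree_X_add_C _).le).trans ?_
  simp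

/-- `deg numPoly_b ≤ 1 + 2 Σ_j b_j`. -/
theorem natDegree_numPoly_le (b : ℕ → ℤ) :
    (numPoly b).natDegree ≤ 1 + 2 * ∑ j ∈ range 7, (b (j + 1)).toNat := by
  unfold numPoly
  refine natDegree_mul_le.trans ?_
  have h1 : (C (2 : ℚ) * X + C (b 0 : ℚ)).natDegree ≤ 1 := natDegree_linear_le
  have h2 : (∏ j ∈ range 7, (pochPoly 0 (b (j + 1)).toNat *
      pochPoly ((b 0 - b (j + 1) + 1 : ℤ) : ℚ) (b (j + 1)).toNat)).natDegree ≤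
      ∑ j ∈ range 7, 2 * (b (j + 1)).toNat := by
    refine (natDegree_prod_le _ _).trans (sum_le_sum fun j _ => ?_)
    refine natDegree_mul_le.trans ?_
    have e1 := natDegree_pochPoly_le 0 (b (j + 1)).toNat
    have e2 := natDegree_pochPoly_le ((b 0 - b (j + 1) + 1 : ℤ) : ℚ) (b (j + 1)).toNat
    omega
  calc _ ≤ 1 + ∑ j ∈ range 7, 2 * (b (j + 1)).toNat := add_le_add h1 h2
    _ = _ := by rw [mul_sum]

/-- `numPoly_b(t) = (2t + b₀) ∏_j (t)_{b_j} (t + b₀ − b_j + 1)_{b_j}` over `ℚ`. -/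
theorem eval_numPoly (b : ℕ → ℤ) (t : ℚ) :
    (numPoly b).eval t = (2 * t + b 0) * ∏ j ∈ range 7,
      (Literature.NumberTheory.Transcendental.BallRivoal.poch t (b (j + 1)).toNat *
        Literature.NumberTheory.Transcendental.BallRivoal.poch
          (t + ((b 0 - b (j + 1) + 1 : ℤ) : ℚ)) (b (j + 1)).toNat) := by
  unfold numPoly
  rw [eval_mul, eval_prod]
  congr 1
  · simp
  · refine prod_congr rfl fun j _ => ?_
    rw [eval_mul, eval_pochPoly, eval_pochPoly, add_zero]

/-- One pair of Pochhammer factors is invariant under the reflection `t ↦ −b₀ − t`: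
`(−b₀−t)_n (−b₀−t+c)_n = (t)_n (t+c)_n` for `c = b₀ − n + 1`. -/
theorem poch_pair_reflect (t b₀ c : ℚ) (n : ℕ) (hc : c = b₀ - n + 1) :
    Literature.NumberTheory.Transcendental.BallRivoal.poch (-b₀ - t) n *
        Literature.NumberTheory.Transcendental.BallRivoal.poch (-b₀ - t + c) n =
      Literature.NumberTheory.Transcendental.BallRivoal.poch t n *
        Literature.NumberTheory.Transcendental.BallRivoal.poch (t + c) n := by
  have h1 := poch_reflect (t + c) n
  rw [show -(t + c) - (n : ℚ) + 1 = -b₀ - t by rw [hc]; ring] at h1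
  have h2 := poch_reflect t n
  rw [show -t - (n : ℚ) + 1 = -b₀ - t + c by rw [hc]; ring] at h2
  rw [h1, h2]
  have hsq : ((-1 : ℚ) ^ n) * (-1) ^ n = 1 := by
    rw [← pow_add, ← two_mul, pow_mul]
    norm_num
  linear_combination
    (Literature.NumberTheory.Transcendental.BallRivoal.poch (t + c) n *
      Literature.NumberTheory.Transcendental.BallRivoal.poch t n) * hsq

/-- The well-poised REFLECTION: `numPoly_b(−b₀ − X) = −numPoly_b(X) = (−1)^{6(b₀+1)+1} numPoly_b(X)`
(the symmetry hypothesis of Cresson–Fischler–Rivoal's Théorème 1 with `A = 6`, `n = b₀`). -/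
theorem numPoly_reflect (b : ℕ → ℤ) (hb : InBox b) :
    (numPoly b).comp (-((b 0).toNat : ℚ[X]) - X) =
      (-1 : ℚ[X]) ^ (6 * ((b 0).toNat + 1) + 1) * numPoly b := by
  obtain ⟨h0, hj⟩ := hb
  have hb0 : (((b 0).toNat : ℕ) : ℚ) = (b 0 : ℚ) := by exact_mod_cast Int.toNat_of_nonneg h0
  have hbj : ∀ j ∈ range 7, (((b (j + 1)).toNat : ℕ) : ℚ) = (b (j + 1) : ℚ) := fun j hj' => by
    exact_mod_cast Int.toNat_of_nonneg (hj j hj').1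
  apply Polynomial.funext
  intro t
  rw [eval_comp, eval_sub, eval_neg, eval_natCast, eval_X, eval_mul, eval_pow, eval_neg, eval_one,
    Odd.neg_one_pow ⟨3 * ((b 0).toNat + 1), by ring⟩, eval_numPoly, eval_numPoly, hb0, neg_one_mul]
  have hfac : ∀ j ∈ range 7,
      Literature.NumberTheory.Transcendental.BallRivoal.poch (-(b 0 : ℚ) - t) (b (j + 1)).toNat *
        Literature.NumberTheory.Transcendental.BallRivoal.poch
          (-(b 0 : ℚ) - t + ((b 0 - b (j + 1) + 1 : ℤ) : ℚ)) (b (j + 1)).toNat =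
      Literature.NumberTheory.Transcendental.BallRivoal.poch t (b (j + 1)).toNat *
        Literature.NumberTheory.Transcendental.BallRivoal.poch
          (t + ((b 0 - b (j + 1) + 1 : ℤ) : ℚ)) (b (j + 1)).toNat := fun j hj' =>
    poch_pair_reflect t (b 0) _ _ (by rw [hbj j hj']; push_cast; ring)
  rw [prod_congr rfl hfac]
  ring

/-! ### Convergence and the decomposition `F̃₇(b) ∈ ℚ + ℚζ(3) + ℚζ(5)` -/

/-- The odd integers in `[3, 6]` are `3` and `5`. -/
theorem filter_odd_Icc_three_six : (Icc 3 6).filter Odd = ({3, 5} : Finset ℕ) := by decide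

/-- Cresson–Fischler–Rivoal's Théorème 1 applied to `numPoly b` (`A = 6`, `n = b₀`): for `b` in the box with
`Σ_j b_j ≤ 3b₀ + 1` the series (34) converges to `a₀ + a₃ζ(3) + a₅ζ(5)` with rational `a`. -/
theorem exists_hasSum_term (b : ℕ → ℤ) (hb : InBox b) (hsum : ∑ j ∈ range 7, b (j + 1) ≤ 3 * b 0 + 1) :
    ∃ a : ℕ → ℚ, HasSum (term b) ((a 0 : ℝ) + ((a 3 : ℝ) * zetaValue 3 + (a 5 : ℝ) * zetaValue 5)) := by
  have hb' := hb
  obtain ⟨h0, hj⟩ := hb'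
  set B := (b 0).toNat with hB
  have hb0 : (b 0 : ℤ) = (B : ℤ) := (Int.toNat_of_nonneg h0).symm
  have hS : ∑ j ∈ range 7, b (j + 1) = ((∑ j ∈ range 7, (b (j + 1)).toNat : ℕ) : ℤ) := by
    rw [Nat.cast_sum]
    exact sum_congr rfl fun j hj' => (Int.toNat_of_nonneg (hj j hj').1).symm
  have hdeg : (numPoly b).natDegree + 2 ≤ 6 * (B + 1) := by
    have h1 := natDegree_numPoly_le b
    have h2 : ((∑ j ∈ range 7, (b (j + 1)).toNat : ℕ) : ℤ) ≤ 3 * (B : ℤ) + 1 := by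
      rw [← hS, ← hb0]; exact hsum
    omega
  obtain ⟨a, ha⟩ := theoreme1_holds B 6 (numPoly b) (by norm_num) hdeg (numPoly_reflect b hb)
  refine ⟨a, ?_⟩
  have hfun : term b = fun k : ℕ => (aeval ((k : ℝ) + 1) (numPoly b)) / poch (k + 1) B ^ 6 :=
    funext fun k => term_eq b hb k
  rw [hfun]
  rw [filter_odd_Icc_three_six, sum_pair (by norm_num)] at ha
  exact ha

/-- CONVERGENCE of (34) on the box with `Σ_j b_j ≤ 3b₀ + 1`. -/
theorem summable_term (b : ℕ → ℤ) (hb : InBox b) (hsum : ∑ j ∈ range 7, b (j + 1) ≤ 3 * b 0 + 1) :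
    Summable (term b) := by
  obtain ⟨a, ha⟩ := exists_hasSum_term b hb hsum
  exact ha.summable

/-- DECOMPOSITION (Brown–Zudilin's remark under (35), as a theorem): on the box with `Σ_j b_j ≤ 3b₀ + 1`,
`F̃₇(b) = u·ζ(5) + w·ζ(3) − v` for some rationals `u, w, v`, and the series (34) converges to it. -/
theorem vwpDual_seven_mem (b : ℕ → ℤ) (hb : InBox b) (hsum : ∑ j ∈ range 7, b (j + 1) ≤ 3 * b 0 + 1) :
    ∃ u w v : ℚ, HasSum (term b) ((u : ℝ) * zetaValue 5 + w * zetaValue 3 - v) ∧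
      vwpDual 7 b = u * zetaValue 5 + w * zetaValue 3 - v := by
  obtain ⟨a, ha⟩ := exists_hasSum_term b hb hsum
  have hval : ((a 0 : ℝ) + ((a 3 : ℝ) * zetaValue 3 + (a 5 : ℝ) * zetaValue 5)) =
      (a 5 : ℝ) * zetaValue 5 + (a 3 : ℝ) * zetaValue 3 - ((-a 0 : ℚ) : ℝ) := by
    push_cast
    ring
  rw [hval] at ha
  exact ⟨a 5, a 3, -a 0, ha, by rw [vwpDual_seven_eq_tsum, ha.tsum_eq]⟩


end Summit.KontsevichZagierPeriods.Zeta5Search.DualSeries
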